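import Literature.Analysis.FluidPDE.LerayHopfUniformEnergy
import Literature.Analysis.FluidPDE.NSUniqueness2DTruncatedBalance
import Literature.Analysis.FunctionSpaces.TorusHNegOnePairing
import Literature.Analysis.FunctionSpaces.TorusInverseLaplacian
import Literature.Analysis.FluidPDE.TimeAverageMeasureBasic
import HarnessLib

/-!
# Leray–Hopf solutions with a steady mean-zero `L²` force: momentum, Poincaré with mean, dissipation budget

Analysis/FluidPDE support file (all proved). `Literature/Analysis/FluidPDE/LerayHopfUniformEnergy`
proves the trajectory bound `sup_{t ≥ 0} ‖u(t)‖₂ < ∞` (FMRT 2001, Ch. II App. A (A.40)–(A.42),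
Ch. IV (3.2)) for global Leray–Hopf solutions on `T^d` whose slices have ZERO MEAN (lifted to the
energy space `H`, where Poincaré `|u|² ≤ ‖∇u‖²` holds). Here the zero-mean hypothesis on the
solution is traded for a zero-mean hypothesis on the steady force `F ∈ L²`:

* `Torus.lintegral_enorm_sq_le_add_eGradNormSq` — **Poincaré with mean**, for every `w ∈ L²(T^d)`:
  `∫⁻‖w‖ₑ² ≤ ‖∫w‖ₑ² + ‖∇w‖₂²` (Parseval; `|k|² ≥ 1` off the zero mode, `λ₁ = 4π² ≥ 1` not used
  sharply), and its real form;
* `Torus.IsGlobalLerayHopf.integral_eq_integral_of_hasZeroMean` — **momentum is conserved** for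
  `t > 0` when `∫F = 0` (test the time-sliced weak formulation with constant fields,
  `Torus.IsLerayHopfOn.integral_inner_const_eq`);
* `Torus.IsGlobalLerayHopf.norm_sq_add_dissipation_le_of_hasZeroMean` — the processed energy
  inequality `|u(t)|² + ν∫ₛᵗ‖∇u‖² ≤ 2E + (|F|²/ν)(t-s)` (Young with `(F,u) = (F, u - m)`,
  `m = ∫u(τ)` the conserved momentum, and Poincaré with mean);
* `Torus.IsGlobalLerayHopf.toReal_lintegral_eGradNormSq_le_of_hasZeroMean` — FMRT (3.4):
  `ν∫₀ᵀ‖∇u‖² ≤ |u₀|² + (|F|²/ν)T`, whence bounded running means of the dissipation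
  (`isBoundedUnder_timeMean_dissipation`);

The uniform-in-time `L²` bound (FMRT (3.2)) built on these is in
`Literature/Analysis/FluidPDE/LerayHopfUniformEnergyMomentum`.

## References

* C. Foias, O. Manley, R. Rosa, R. Temam, *Navier–Stokes Equations and Turbulence*, CUP 2001,
  Ch. II App. A (A.38)–(A.42); Ch. IV §3.1 (3.2), (3.4). [FMRT2001]
-/

noncomputable section

open _root_.MeasureTheory _root_.Set _root_.Filter _root_.Topology UnitAddTorus
open scoped InnerProductSpace RealInnerProductSpace ENNReal NNReal

namespace Literature.Analysis.FluidPDE.Torus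

variable {d : Type*} [Fintype d] [DecidableEq d]

/-! ### Poincaré with mean -/

section Poincare

omit [DecidableEq d] in
/-- The zero mode of a complexified integrable field is the complexified mean:
`𝓕(complexify ∘ w)(0) = complexify (∫ w)`. [folklore] -/
theorem mFourierCoeff_complexify_zero_eq {w : UnitAddTorus d → EuclideanSpace ℝ d} (hw : Integrable w volume) :
    mFourierCoeff (FunctionSpaces.EuclideanSpace.complexify ∘ w) 0 =
      FunctionSpaces.EuclideanSpace.complexify (∫ x, w x) := by
  rw [FunctionSpaces.Torus.mFourierCoeff_eq_integral_volume]
  have h1 : (fun x : UnitAddTorus d => mFourier (-(0 : d → ℤ)) x • (FunctionSpaces.EuclideanSpace.complexify ∘ w) x) =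
      fun x => FunctionSpaces.EuclideanSpace.complexify.toContinuousLinearMap (w x) := by
    funext x
    rw [neg_zero, Function.comp_apply]
    have : mFourier (0 : d → ℤ) x = 1 := by simp [mFourier]
    rw [this, one_smul]
    rfl
  rw [h1, ContinuousLinearMap.integral_comp_comm _ hw]
  rfl

omit [DecidableEq d] in
/-- **Poincaré with mean** on the unit torus, `ℝ≥0∞` form: for `w ∈ L²(T^d; ℝ^d)`,
`∫⁻ ‖w‖ₑ² ≤ ‖∫ w‖ₑ² + ‖∇w‖₂²` (Parseval; the zero mode is the mean, `|k|² ≥ 1` elsewhere, and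
the factor `4π² ≥ 1` of `eGradNormSq` is dropped; FMRT 2001, Ch. IV (1.13) for mean-zero fields). [folklore] -/
theorem lintegral_enorm_sq_le_add_eGradNormSq {w : UnitAddTorus d → EuclideanSpace ℝ d} (hw : MemLp w 2 volume) :
    ∫⁻ x, ‖w x‖ₑ ^ 2 ≤ ‖∫ x, w x‖ₑ ^ 2 + FunctionSpaces.Torus.eGradNormSq w := by
  classical
  have hwi : Integrable w volume := hw.integrable one_le_two
  rw [← FunctionSpaces.Torus.tsum_enorm_sq_mFourierCoeff_complexify hw, ENNReal.tsum_eq_add_tsum_ite (0 : d → ℤ)]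
  have h0 : ‖mFourierCoeff (FunctionSpaces.EuclideanSpace.complexify ∘ w) 0‖ₑ ^ 2 = ‖∫ x, w x‖ₑ ^ 2 := by
    rw [mFourierCoeff_complexify_zero_eq hwi, ← ofReal_norm, FunctionSpaces.EuclideanSpace.norm_complexify, ofReal_norm]
  rw [h0]
  refine add_le_add le_rfl ?_
  rw [FunctionSpaces.Torus.eGradNormSq_eq_tsum]
  refine le_trans (ENNReal.tsum_le_tsum fun k => ?_) (le_mul_of_one_le_left zero_le (ENNReal.one_le_ofReal.2 ?_))
  · split_ifs with hk
    · exact zero_le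
    · exact le_mul_of_one_le_left zero_le
        (ENNReal.one_le_ofReal.2 (FunctionSpaces.Torus.one_le_freqNormSq_of_ne_zero hk))
  · nlinarith [Real.two_le_pi, Real.pi_pos]

omit [DecidableEq d] in
/-- **Poincaré with mean**, real form: for `w ∈ L²` with finite dissipation,
`∫ ‖w‖² ≤ ‖∫ w‖² + (‖∇w‖₂²).toReal`. [folklore] -/
theorem integral_norm_sq_le_add_toReal_eGradNormSq {w : UnitAddTorus d → EuclideanSpace ℝ d} (hw : MemLp w 2 volume)
    (hG : FunctionSpaces.Torus.eGradNormSq w ≠ ⊤) :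
    ∫ x, ‖w x‖ ^ 2 ≤ ‖∫ x, w x‖ ^ 2 + (FunctionSpaces.Torus.eGradNormSq w).toReal := by
  have h := lintegral_enorm_sq_le_add_eGradNormSq hw
  rw [Torus.lintegral_enorm_sq_eq_ofReal hw, ← ofReal_norm, ← ENNReal.ofReal_pow (norm_nonneg _),
    ← ENNReal.ofReal_toReal hG, ← ENNReal.ofReal_add (sq_nonneg _) ENNReal.toReal_nonneg] at h
  exact (ENNReal.ofReal_le_ofReal_iff (add_nonneg (sq_nonneg _) ENNReal.toReal_nonneg)).1 h

omit [DecidableEq d] in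
/-- The variance identity `∫ ‖w - ∫w‖² = ∫ ‖w‖² - ‖∫w‖²` for `w ∈ L²(T^d)`. [folklore] -/
theorem integral_norm_sub_integral_sq {w : UnitAddTorus d → EuclideanSpace ℝ d} (hw : MemLp w 2 volume) :
    ∫ x, ‖w x - ∫ y, w y‖ ^ 2 = (∫ x, ‖w x‖ ^ 2) - ‖∫ y, w y‖ ^ 2 := by
  set m : EuclideanSpace ℝ d := ∫ y, w y with hm
  have hwi : Integrable w volume := hw.integrable one_le_two
  have h2 : Integrable (fun x => ‖w x‖ ^ 2) volume := hw.integrable_norm_pow two_ne_zero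
  have h1 : Integrable (fun x => ⟪m, w x⟫) volume := (hwi.norm.const_mul ‖m‖).mono'
    (aestronglyMeasurable_const.inner (𝕜 := ℝ) hwi.aestronglyMeasurable)
    (ae_of_all _ fun x => by simpa using norm_inner_le_norm (𝕜 := ℝ) m (w x))
  have hpt : ∀ x, ‖w x - m‖ ^ 2 = ‖w x‖ ^ 2 - 2 * ⟪m, w x⟫ + ‖m‖ ^ 2 := fun x => by
    rw [@norm_sub_sq_real, real_inner_comm]
  simp_rw [hpt]
  have i1 : Integrable (fun x => ‖w x‖ ^ 2 - 2 * ⟪m, w x⟫) volume := h2.sub (h1.const_mul 2)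
  rw [integral_add i1 (integrable_const _), integral_sub h2 (h1.const_mul 2),
    integral_const_mul, integral_inner hwi m, integral_const, probReal_univ, one_smul, ← hm,
    real_inner_self_eq_norm_sq]
  ring

end Poincare

/-! ### Steady mean-zero forces: measurability, work, Young -/

section Force

variable {ν : ℝ} {F : UnitAddTorus d → EuclideanSpace ℝ d}

omit [DecidableEq d] in
/-- The space–time lift of a steady measurable field is measurable on every slab. [folklore] -/
theorem aestronglyMeasurable_stLift_steady (hF : AEStronglyMeasurable F volume) (S : Set ℝ) :
    AEStronglyMeasurable (FunctionSpaces.Torus.stLift (fun _ : ℝ => F))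
      (volume.restrict (S ×ˢ (univ : Set (EuclideanSpace ℝ d)))) :=
  FunctionSpaces.Torus.aestronglyMeasurable_stLift_of_uncurry (u := fun _ : ℝ => F) hF.comp_snd

omit [DecidableEq d] in
/-- A steady `L²` field has finite space–time `L²` mass on every `(0, T) × T^d`. [folklore] -/
theorem lintegral_enorm_sq_steady_lt_top' (hF : MemLp F 2 volume) (T : ℝ) :
    ∫⁻ _ in Ioo (0 : ℝ) T, ∫⁻ x, ‖F x‖ₑ ^ 2 < ⊤ := by
  rw [setLIntegral_const]
  refine ENNReal.mul_lt_top ?_ measure_Ioo_lt_top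
  have h := lintegral_rpow_enorm_lt_top_of_eLpNorm_lt_top two_ne_zero ENNReal.ofNat_ne_top hF.eLpNorm_lt_top
  simpa only [ENNReal.toReal_ofNat, ENNReal.rpow_ofNat] using h

omit [DecidableEq d] in
/-- A mean-zero force does no work on constants: `∫ ⟪F, w⟫ = ∫ ⟪F, w - c⟫` for `F, w ∈ L²`. [folklore] -/
theorem integral_inner_eq_integral_inner_sub_const (hF : MemLp F 2 volume) (hF0 : FunctionSpaces.Torus.HasZeroMean F)
    {w : UnitAddTorus d → EuclideanSpace ℝ d} (hw : MemLp w 2 volume) (c : EuclideanSpace ℝ d) :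
    ∫ x, ⟪F x, w x⟫ = ∫ x, ⟪F x, w x - c⟫ := by
  have hFi : Integrable F volume := hF.integrable one_le_two
  have h1 : Integrable (fun x => ⟪F x, c⟫) volume := (hFi.norm.mul_const ‖c‖).mono'
    (hFi.aestronglyMeasurable.inner (𝕜 := ℝ) aestronglyMeasurable_const)
    (ae_of_all _ fun x => by simpa using norm_inner_le_norm (𝕜 := ℝ) (F x) c)
  have h2 : Integrable (fun x => ⟪F x, w x⟫) volume := integrable_inner_of_memLp_two hF hw
  have hc : ∫ x, ⟪F x, c⟫ = 0 := by
    have hflip : (∫ x, ⟪F x, c⟫) = ∫ x, ⟪c, F x⟫ := integral_congr_ae (ae_of_all _ fun x => real_inner_comm _ _)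
    rw [hflip, integral_inner hFi c]
    unfold FunctionSpaces.Torus.HasZeroMean at hF0
    rw [hF0, inner_zero_right]
  simp_rw [inner_sub_right]
  rw [integral_sub h2 h1, hc, sub_zero]

omit [DecidableEq d] in
/-- **Young's inequality for a mean-zero steady force**, with Poincaré with mean:
`(F, w) ≤ |F|²/(2ν) + (ν/2)‖∇w‖₂²` for `ν > 0`, `F, w ∈ L²`, `∫F = 0`, `‖∇w‖₂ < ∞`
(FMRT 2001, Ch. II App. A (A.38)–(A.39), without the zero-mean normalisation of `w`). [cite: FMRT2001, Ch. II App. A (A.38)–(A.40)] -/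
theorem integral_inner_le_young_of_hasZeroMean (hν : 0 < ν) (hF : MemLp F 2 volume)
    (hF0 : FunctionSpaces.Torus.HasZeroMean F) {w : UnitAddTorus d → EuclideanSpace ℝ d} (hw : MemLp w 2 volume)
    (hG : FunctionSpaces.Torus.eGradNormSq w ≠ ⊤) :
    ∫ x, ⟪F x, w x⟫ ≤ (∫ x, ‖F x‖ ^ 2) / (2 * ν) + ν / 2 * (FunctionSpaces.Torus.eGradNormSq w).toReal := by
  have hm : MemLp (fun x => w x - ∫ y, w y) 2 volume := hw.sub (memLp_const _)
  rw [integral_inner_eq_integral_inner_sub_const hF hF0 hw (∫ y, w y)]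
  refine (integral_inner_le_young hν hF hm).trans ?_
  rw [integral_norm_sub_integral_sq hw]
  have hP := integral_norm_sq_le_add_toReal_eGradNormSq hw hG
  nlinarith

end Force

/-! ### Momentum conservation -/

section Momentum

variable {ν : ℝ} {F u₀ : UnitAddTorus d → EuclideanSpace ℝ d} {u : ℝ → UnitAddTorus d → EuclideanSpace ℝ d}

/-- **Momentum is conserved under a mean-zero steady force**: for a global Leray–Hopf solution
on `T^d` with force `F ∈ L²`, `∫F = 0`, the momentum `∫ u(t)` is the same at all positive times
(test the time-sliced weak formulation with constant fields; the slice `t = 0` is excluded, the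
solution class leaving it free). [folklore] -/
theorem IsGlobalLerayHopf.integral_eq_integral_of_hasZeroMean (hu : IsGlobalLerayHopf ν (fun _ => F) u₀ u)
    (hF : MemLp F 2 volume) (hF0 : FunctionSpaces.Torus.HasZeroMean F) {s t : ℝ} (hs : 0 < s) (ht : 0 < t) :
    ∫ x, u t x = ∫ x, u s x := by
  set T : ℝ := max s t + 1 with hT
  have hTpos : 0 < T := by rw [hT]; positivity
  have hsT : s ∈ Ioc 0 T := ⟨hs, by rw [hT]; linarith [le_max_left s t]⟩
  have htT : t ∈ Ioc 0 T := ⟨ht, by rw [hT]; linarith [le_max_right s t]⟩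
  have hLH := hu T hTpos
  have hfm := aestronglyMeasurable_stLift_steady hF.1 (Ioo 0 T)
  have hf₂ := lintegral_enorm_sq_steady_lt_top' hF T
  have hFi : Integrable F volume := hF.integrable one_le_two
  have hflip : ∀ (g : UnitAddTorus d → EuclideanSpace ℝ d) (e : EuclideanSpace ℝ d), (∫ x, ⟪e, g x⟫) = ∫ x, ⟪g x, e⟫ := fun g e =>
    integral_congr_ae (ae_of_all _ fun x => real_inner_comm _ _)
  have hF0' : ∫ x, F x = 0 := hF0
  have hconst : ∀ e : EuclideanSpace ℝ d, ∀ r ∈ Ioc 0 T, ∫ x, ⟪u r x, e⟫ = ∫ x, ⟪u₀ x, e⟫ := by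
    intro e r hr
    rw [hLH.integral_inner_const_eq hTpos hfm hf₂ e hr]
    have h0 : (∫ x, ⟪F x, e⟫) = 0 := by
      rw [← hflip F e, integral_inner hFi e, hF0', inner_zero_right]
    simp [h0]
  have hut : Integrable (u t) volume := (hu.memLp_two ht.le).integrable one_le_two
  have hus : Integrable (u s) volume := (hu.memLp_two hs.le).integrable one_le_two
  refine ext_inner_left ℝ fun e => ?_
  rw [← integral_inner hut e, ← integral_inner hus e, hflip, hflip, hconst e t htT, hconst e s hsT]

end Momentum

/-! ### Energy estimates -/

section Energy

variable {ν : ℝ} {F u₀ : UnitAddTorus d → EuclideanSpace ℝ d} {u : ℝ → UnitAddTorus d → EuclideanSpace ℝ d}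

/-- **The energy inequality processed, any momentum**: if the Leray–Hopf energy inequality holds
between `s ≥ 0` and `t ≥ s` with initial energy `E`, for a global Leray–Hopf solution with
steady force `F ∈ L²` of zero mean and `ν > 0`, then
`|u(t)|² + ν ∫ₛᵗ ‖∇u‖₂² ≤ 2E + (|F|²/ν)(t - s)` (Young `2(F,u) ≤ |F|²/ν + ν‖∇u‖²` slice-wise, by
`integral_inner_le_young_of_hasZeroMean`; FMRT 2001, Ch. II App. A (A.38)–(A.40)). [cite: FMRT2001, Ch. II App. A (A.38)–(A.40)] -/
theorem IsGlobalLerayHopf.norm_sq_add_dissipation_le_of_hasZeroMean (hν : 0 < ν) (hF : MemLp F 2 volume)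
    (hF0 : FunctionSpaces.Torus.HasZeroMean F) (hu : IsGlobalLerayHopf ν (fun _ => F) u₀ u)
    {s t E : ℝ} (hs : 0 ≤ s) (hst : s ≤ t)
    (hE : FunctionSpaces.Torus.kineticEnergy (u t) +
        ν * (∫⁻ τ in Ioo s t, FunctionSpaces.Torus.eGradNormSq (u τ)).toReal ≤
      E + ∫ τ in s..t, ∫ x, ⟪F x, u τ x⟫) :
    (∫ x, ‖u t x‖ ^ 2) + ν * (∫⁻ τ in Ioo s t, FunctionSpaces.Torus.eGradNormSq (u τ)).toReal ≤
      2 * E + (∫ x, ‖F x‖ ^ 2) / ν * (t - s) := by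
  set D : ℝ := (∫⁻ τ in Ioo s t, FunctionSpaces.Torus.eGradNormSq (u τ)).toReal with hD
  set A : ℝ := (∫ x, ‖F x‖ ^ 2) / (2 * ν) with hA
  have hA0 : 0 ≤ A := div_nonneg (integral_nonneg fun x => sq_nonneg _) (by positivity)
  -- the forcing term: `∫ₛᵗ (F, u) ≤ A (t - s) + (ν/2) D`
  have hforce : ∫ τ in s..t, ∫ x, ⟪F x, u τ x⟫ ≤ A * (t - s) + ν / 2 * D := by
    rcases eq_or_lt_of_le hst with hst' | hst'
    · subst hst'
      simp only [intervalIntegral.integral_same, sub_self, mul_zero, zero_add]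
      exact mul_nonneg (by positivity) ENNReal.toReal_nonneg
    have hLH := hu (t + 1) (by linarith)
    have hsub : Ioo s t ⊆ Ioo 0 (t + 1) := Ioo_subset_Ioo hs (by linarith)
    have hmeas : AEMeasurable (fun τ => FunctionSpaces.Torus.eGradNormSq (u τ)) (volume.restrict (Ioo s t)) :=
      hLH.aemeasurable_eGradNormSq.mono_measure (Measure.restrict_mono hsub le_rfl)
    have hfin : ∫⁻ τ in Ioo s t, FunctionSpaces.Torus.eGradNormSq (u τ) < ⊤ :=
      (lintegral_mono_set hsub).trans_lt hLH.lintegral_eGradNormSq_lt_top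
    have hlt : ∀ᵐ τ ∂(volume.restrict (Ioo s t)), FunctionSpaces.Torus.eGradNormSq (u τ) < ⊤ :=
      ae_lt_top' hmeas hfin.ne
    have hGi : IntegrableOn (fun τ => (FunctionSpaces.Torus.eGradNormSq (u τ)).toReal) (Ioo s t) :=
      integrable_toReal_of_lintegral_ne_top hmeas hfin.ne
    have hDeq : ∫ τ in Ioo s t, (FunctionSpaces.Torus.eGradNormSq (u τ)).toReal = D := by
      rw [hD, integral_toReal hmeas hlt]
    rw [← integral_Ioc_eq_integral_Ioo] at hDeq
    rw [intervalIntegral.integral_of_le hst]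
    haveI : IsFiniteMeasure (volume.restrict (Ioc s t)) :=
      ⟨by rw [Measure.restrict_apply_univ]; exact measure_Ioc_lt_top⟩
    have hAi : Integrable (fun _ : ℝ => A) (volume.restrict (Ioc s t)) := integrable_const A
    have hGi' : IntegrableOn (fun τ => (FunctionSpaces.Torus.eGradNormSq (u τ)).toReal) (Ioc s t) :=
      hGi.congr_set_ae (Ioo_ae_eq_Ioc (μ := volume)).symm
    have hrhs : A * (t - s) + ν / 2 * D = ∫ τ in Ioc s t, (A + ν / 2 * (FunctionSpaces.Torus.eGradNormSq (u τ)).toReal) := by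
      rw [integral_add hAi (hGi'.const_mul _), integral_const_mul, setIntegral_const,
        Real.volume_real_Ioc_of_le hst, smul_eq_mul, mul_comm, hDeq]
    by_cases hint : IntegrableOn (fun τ => ∫ x, ⟪F x, u τ x⟫) (Ioc s t)
    · rw [hrhs]
      refine integral_mono_ae hint (hAi.add (hGi'.const_mul _)) ?_
      have hlt' : ∀ᵐ τ ∂(volume.restrict (Ioc s t)), FunctionSpaces.Torus.eGradNormSq (u τ) < ⊤ := by
        rw [← Measure.restrict_congr_set (Ioo_ae_eq_Ioc (μ := (volume : Measure ℝ)) (a := s) (b := t))]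
        exact hlt
      filter_upwards [ae_restrict_mem measurableSet_Ioc, hlt'] with τ hτ hτG
      exact integral_inner_le_young_of_hasZeroMean hν hF hF0 (hu.memLp_two (hs.trans hτ.1.le)) hτG.ne
    · rw [integral_undef hint]
      exact add_nonneg (mul_nonneg hA0 (sub_nonneg.2 hst)) (mul_nonneg (by positivity) ENNReal.toReal_nonneg)
  have hkin : FunctionSpaces.Torus.kineticEnergy (u t) = 2⁻¹ * ∫ x, ‖u t x‖ ^ 2 := rfl
  rw [hkin] at hE
  have h2A : 2 * A = (∫ x, ‖F x‖ ^ 2) / ν := by rw [hA]; field_simp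
  rw [← h2A]
  nlinarith [hE, hforce, hν]

/-- **Time-averaged dissipation bound, FMRT (3.4), any momentum**: for a global Leray–Hopf
solution with steady mean-zero force `F ∈ L²` and `ν > 0`,
`ν ∫₀ᵀ ‖∇u‖₂² ≤ |u₀|² + (|F|²/ν) T` for every `T ≥ 0` (`|u₀|² = 2 · kineticEnergy u₀`). [cite: FMRT2001, Ch. IV §3.1 (3.4)] -/
theorem IsGlobalLerayHopf.toReal_lintegral_eGradNormSq_le_of_hasZeroMean (hν : 0 < ν) (hF : MemLp F 2 volume)
    (hF0 : FunctionSpaces.Torus.HasZeroMean F) (hu : IsGlobalLerayHopf ν (fun _ => F) u₀ u) {T : ℝ} (hT : 0 ≤ T) :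
    ν * (∫⁻ τ in Ioo 0 T, FunctionSpaces.Torus.eGradNormSq (u τ)).toReal ≤
      2 * FunctionSpaces.Torus.kineticEnergy u₀ + (∫ x, ‖F x‖ ^ 2) / ν * T := by
  have hE := (hu (T + 1) (by linarith)).energy_ineq_zero T ⟨hT, by linarith⟩
  have h := hu.norm_sq_add_dissipation_le_of_hasZeroMean hν hF hF0 le_rfl hT hE
  rw [sub_zero] at h
  have h0 : 0 ≤ ∫ x, ‖u T x‖ ^ 2 := integral_nonneg fun x => sq_nonneg _
  linarith

/-- **The running means of the dissipation are bounded** (fixed viscosity): along a global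
Leray–Hopf solution with steady mean-zero force `F ∈ L²`, `ν > 0`, the Cesàro means
`T⁻¹ ∫₀ᵀ ν‖∇u(t)‖₂² dt` are eventually bounded (by `|u₀|² + |F|²/ν` for `T ≥ 1`). [folklore] -/
theorem IsGlobalLerayHopf.isBoundedUnder_timeMean_dissipation (hν : 0 < ν) (hF : MemLp F 2 volume)
    (hF0 : FunctionSpaces.Torus.HasZeroMean F) (hu : IsGlobalLerayHopf ν (fun _ => F) u₀ u) :
    IsBoundedUnder (· ≤ ·) atTop (timeMean fun t => ν * (FunctionSpaces.Torus.eGradNormSq (u t)).toReal) := by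
  set E₀ : ℝ := 2 * FunctionSpaces.Torus.kineticEnergy u₀ with hE₀
  set C : ℝ := (∫ x, ‖F x‖ ^ 2) / ν with hC
  refine ⟨E₀ + C, ?_⟩
  rw [Filter.eventually_map]
  filter_upwards [eventually_ge_atTop (1 : ℝ)] with T hT1
  have hT : 0 < T := by linarith
  have hLH := hu T hT
  have hmeas := hLH.aemeasurable_eGradNormSq
  have hfin := hLH.lintegral_eGradNormSq_lt_top
  have hlt : ∀ᵐ τ ∂(volume.restrict (Ioo 0 T)), FunctionSpaces.Torus.eGradNormSq (u τ) < ⊤ := ae_lt_top' hmeas hfin.ne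
  unfold timeMean
  rw [intervalIntegral.integral_of_le hT.le, integral_Ioc_eq_integral_Ioo, integral_const_mul,
    integral_toReal hmeas hlt]
  have hb := hu.toReal_lintegral_eGradNormSq_le_of_hasZeroMean hν hF hF0 hT.le
  have hE₀0 : 0 ≤ E₀ := mul_nonneg zero_le_two (FunctionSpaces.Torus.kineticEnergy_nonneg _)
  have hC0 : 0 ≤ C := div_nonneg (integral_nonneg fun x => sq_nonneg _) hν.le
  have hTinv : 0 ≤ T⁻¹ := inv_nonneg.2 hT.le
  calc T⁻¹ * (ν * (∫⁻ τ in Ioo 0 T, FunctionSpaces.Torus.eGradNormSq (u τ)).toReal)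
      ≤ T⁻¹ * (E₀ + C * T) := mul_le_mul_of_nonneg_left hb hTinv
    _ = T⁻¹ * E₀ + C := by field_simp
    _ ≤ E₀ + C := by
        have : T⁻¹ * E₀ ≤ 1 * E₀ := mul_le_mul_of_nonneg_right (inv_le_one_of_one_le₀ hT1) hE₀0
        linarith

end Energy

end Literature.Analysis.FluidPDE.Torus

end
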